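import Summits.HodgeConjecture.HodgeConjecture.Theorems.SixfoldTableXCensusTypeIIRatRow
import Literature.AlgebraicGeometry.HodgeTheory.RibetTypeOnePowersHodgeClasses
import Literature.AlgebraicGeometry.HodgeTheory.QuaternionMinimalPowersHodgeClasses
import HarnessLib

/-!
# TABLE X (dimension 6) — row 8a `g6.IV(1,1).(5,1)` (End⁰ an IMAGINARY QUADRATIC field acting with multiplicities
# `(5,1)`: Ribet 1983 Thm. 3, ALL members) and row 6 `g6.II(3)` in its LITERAL Albert form (End⁰ a quaternion algebra
# over a totally real cubic field): the census nodes X2 / X1 DISCHARGED IN THE KERNEL, with domain membership,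
# unconditionally (cell `pub-hodgeav-hg6`, req-37 (A) Q2b; eng-4 g4, sequel of L10 / L10b / L10c)

HONEST FRAMING. HC, `HC_AV` (stmt-1333), `HC_CM` (stmt-3052) and the rung H2 are NOT proved and do not occur here. The
census nodes X2 / X1 (`TableX.SixfoldCodimTwoCensus` / `TableX.SixfoldCodimThreeCensus` of `SixfoldTableXCover`) are OURS
(`@[conjecture]`), never asserted. KERNEL ONLY: theorems over existing declarations; no definition, no `sorry`, no named
fact (every input is a THEOREM of the tree); typed ≠ proved.

WHY THIS MODULE (census-node self-audit, axis A7 «a row VERIFIED in the kernel, not by dossier», continued). L10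
(`SixfoldTableXCensusSimpleRows`) recorded rows 8 / 10 / 12 (type IV, non-Weil) as «no tree `B = D` theorem; Ribet's
coprime-signature theorem is a named fact only», and the decision record (v1.8 §7) booked them as fact-bound general-member
rows. For the sub-row of row 8 with multiplicities `(5,1)` that is out of date: the Literature file
`HodgeTheory/RibetTypeOnePowersHodgeClasses` (2026-08-22) PROVES Ribet 1983 Thm. 3 in the case `(n', n'') = (dim A − 1, 1)`,
`dim A ≥ 3`, fact-free — `AbelianVariety.isDivisorGenerated_of_ribetTypeOne` (`φ ≫ φ = −d`, `d > 0`, `dim_ℚ End⁰(A) = 2`,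
multiplicity `1` at `i√d` or at `−i√d`) — on EVERY such abelian variety (the coprimality `(5,1)` forces `Hg = U_k(V,ψ)`;
no «general member» proviso) and on all its powers. Only the case `min(n', n'') ≥ 2` of Ribet's theorem (here: nothing,
`(4,2)` is not coprime; `(3,3)` is the Weil row 9) remains the named fact `Ribet1983_…_imaginaryQuadraticCoprime`.
* §1 ROW 8a `g6.IV(1,1).(5,1)`, KERNEL VERDICT on the whole isogeny class WITH DOMAIN MEMBERSHIP:
  `SimpleRows.census_row8_fiveOne` — `B` simple, `dim B = 6`, `φ ≫ φ = −d` (`d > 0`), `dim_ℚ End⁰(B) = 2`, multiplicity `1`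
  at `± i√d` ⟹ every `A ∼ B`: `dim A = 6 ∧ ¬ 𝒞 A` AND X2-at-`A` ∧ X1-at-`A` (UNCONDITIONAL); `…_powSucc_…` for the powers
  (conclusions only); and the dimension-free form `census_of_isIsogenous_powSucc_of_ribetTypeOne` (`dim B ≥ 3`).
* §2 ROW 6 `g6.II(3)` LITERALLY: L10 / L10b typed row 6 through a Murty packet «`End⁰(B)` non-commutative with a
  self-commutant totally real SEXTIC subfield» and called «type II(3) ⟹ these hypotheses» Albert MEMBERSHIP prose. The
  tree has the literal form too: `AbelianVariety.isDivisorGenerated_of_isSimple_quaternion_of_dim_eq` (file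
  `QuaternionMinimalPowersHodgeClasses`: `End⁰(B)` a quaternion algebra over a totally real field `K`, `dim B = 2[K:ℚ]`;
  indefiniteness is AUTOMATIC, `isTotallyIndefinite_of_isSimple_of_dim_eq` — type III(3) sixfolds do not exist). Hence
  `SimpleRows.census_row6_typeII_cubic` — `B` simple, `dim B = 6`, `End⁰(B)` a quaternion algebra over a totally real
  CUBIC field ⟹ every `A ∼ B`: `dim A = 6 ∧ ¬ 𝒞 A` AND X2-at-`A` ∧ X1-at-`A`; no membership prose left.
FLOOR REMARK: on both rows the CONCLUSION of L6 (`HodgeConjectureFor`) is an unconditional tree theorem BY NAME —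
`hodgeConjectureFor_of_ribetTypeOne` / `…_powSucc_…` / `…_of_isIsogenous_powSucc_of_ribetTypeOne`,
`hodgeConjectureFor_self_of_isSimple_quaternion_of_dim_eq` / `…_powSucc_…` — nothing is restated. No inhabitant is
exhibited (no existence record for either row in the tree; none invented). After L10c and this file the rows of TABLE X
NOT on axis A7 are exactly: row 1 `g6.I(1)` (`End⁰ = ℚ`: Tankeev / Pink 5.14 named fact — the tree's classification-free
Hodge–Lie theory stops at rank `10`, `Motives/HodgeLieWeightOneRankTenSymplectic`), row 8b `(4,2)`, rows 10 / 12 (quartic /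
sextic CM centre; general member only), the Weil rows 7 / 9 / 11 / 13, the K3-partner rows and the CM rows.

All declarations in the sub-namespace `TableX.SimpleRows` (lead g2 DEDUP RULE 2026-08-28T20:17:40Z). Nothing here is a
corollary of `HC_CM`; no hypothesis of the cover is discharged GLOBALLY (X2 / X1 quantify over ALL off-residue sixfolds and
stay `@[conjecture]`); typed ≠ proved.
-/

set_option linter.dupNamespace false

noncomputable section

open CategoryTheory
open Literature.AlgebraicGeometry Literature.AlgebraicGeometry.Motives
open Literature.AlgebraicGeometry.Motives.AbelianVariety (IsIsogenous IsSimple)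
open Literature.AlgebraicGeometry.HodgeTheory
open Literature.AlgebraicGeometry.Milne1999
open Literature.AlgebraicTopology.SingularHomology
open Literature.Barriers.HodgeConjecture
open Literature.NumberTheory.Automorphic (IsQuaternionAlgebra)
open Summit.HodgeConjecture.HodgeConjecture.Ring2.ClassTargets
open Summit.HodgeConjecture.HodgeConjecture.Ring2.Motiv (ProdCMCell)
open Summit.HodgeConjecture.HodgeConjecture.Ring2.Atlas (IsQuarticFieldTypeIVFourfold)

namespace Summit.HodgeConjecture.HodgeConjecture.TableX.SimpleRows

/-! ## §1 Row 8a `g6.IV(1,1).(5,1)`: imaginary quadratic `End⁰` of multiplicities `(5,1)` (Ribet 1983 Thm. 3, case `(dim − 1, 1)`) -/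

section RibetTypeOne

/-- **Both census conclusions at every `A` isogenous to a power `B^{N+1}` of an abelian variety `B` of Ribet type
`(dim B − 1, 1)`, `dim B ≥ 3`** (`φ ≫ φ = −d`, `d > 0`, `dim_ℚ End⁰(B) = 2`, multiplicity `1` at `i√d` or `−i√d`):
`B•(B^{N+1}) = D•(B^{N+1}) ⊗ ℂ` is the tree theorem `AbelianVariety.isDivisorGenerated_powSucc_of_ribetTypeOne` (Ribet
1983 Thm. 3 with Thm. 0, PROVED), and `B = D` on a model gives X2 / X1 at everything isogenous (§1 of L10). UNCONDITIONAL;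
any dimension `≥ 3` (conclusions only). [cite: Ribet1983, Thm. 0 and Thm. 3] [cite: Gordon1997, Thm. 6.3 (3) (p. 18)]
[cite: MoonenZarhin1999LowDim, §2 (2.3)] [cite: vanGeemen1994HodgeAV, §2.4–2.5 and Lemma 3.7] -/
theorem census_of_isIsogenous_powSucc_of_ribetTypeOne {A B : AbelianVariety ℂ} (φ : B ⟶ B) {d : ℕ} (hd : 0 < d)
    (hφ : φ ≫ φ = -(d • 𝟙 B)) (hE2 : Module.finrank ℚ B.endAlgebra = 2)
    (h1 : eigenMultiplicity B φ (Complex.I * (Real.sqrt d : ℂ)) = 1 ∨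
      eigenMultiplicity B φ (-(Complex.I * (Real.sqrt d : ℂ))) = 1)
    (hdim : 3 ≤ B.dim) {N : ℕ} (hAB : IsIsogenous A (B.powSucc N)) :
    (∀ c : complexBetti A.X (2 * 2), IsRationalClass c → IsOfHodgeType A.dim A.X (2 * 2) 2 2 c →
      c ∈ divisorClassesSpan A.X A.dim 2 ⊔ Submodule.span ℂ {w' : complexBetti A.X (2 * 2) |
        ∃ (C : AbelianVariety ℂ) (g : A.X ⟶ C.X) (w : complexBetti C.X (2 * 2)), C.dim < A.dim ∧
          IsRationalClass w ∧ IsOfHodgeType C.dim C.X (2 * 2) 2 2 w ∧ w' = complexBetti.map g (2 * 2) w}) ∧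
    (∀ c : complexBetti A.X (2 * 3), IsRationalClass c → IsOfHodgeType A.dim A.X (2 * 3) 3 3 c →
      c ∈ divisorClassesSpan A.X A.dim 3 ⊔ Submodule.span ℂ {w' : complexBetti A.X (2 * 3) |
          ∃ (a : complexBetti A.X (2 * 2)) (b : complexBetti A.X (2 * 1)),
            IsRationalClass a ∧ IsOfHodgeType A.dim A.X (2 * 2) 2 2 a ∧ IsRationalClass b ∧
            IsOfHodgeType A.dim A.X (2 * 1) 1 1 b ∧ w' = cupProduct (two_mul_add_two_mul 2 1) a b} ⊔
        Submodule.span ℂ {w' : complexBetti A.X (2 * 3) |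
          ∃ (C : AbelianVariety ℂ) (g : A.X ⟶ C.X) (w : complexBetti C.X (2 * 3)), C.dim < A.dim ∧
            IsRationalClass w ∧ IsOfHodgeType C.dim C.X (2 * 3) 3 3 w ∧ w' = complexBetti.map g (2 * 3) w} ⊔
        Submodule.span ℂ {w' : complexBetti A.X (2 * 3) |
          ∃ (B' : AbelianVariety ℂ) (g : A.X ⟶ B'.X) (d : ℕ) (ψ : B' ⟶ B') (w : complexBetti B'.X (2 * 3)),
            B'.dim = 6 ∧ 0 < d ∧ ψ ≫ ψ = -(d • 𝟙 B') ∧ IsRationalClass w ∧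
            IsOfHodgeType B'.dim B'.X (2 * 3) 3 3 w ∧ w ∈ weilClassesOf B' ψ 3 d ∧
            w' = complexBetti.map g (2 * 3) w}) :=
  census_of_isIsogenous_of_isDivisorGenerated hAB
    (AbelianVariety.isDivisorGenerated_powSucc_of_ribetTypeOne B φ hd hφ hE2 h1 hdim N)

/-- **TABLE X ROW 8a `g6.IV(1,1).(5,1)`, KERNEL VERDICT on the whole isogeny class, WITH DOMAIN MEMBERSHIP — ALL members.**
For a SIMPLE complex abelian sixfold `B` whose endomorphism algebra is an imaginary quadratic field `ℚ(√−d)` acting on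
`H^{1,0}` with multiplicities `(5,1)` — rendered as in the tree's Ribet files: `φ ≫ φ = −d` (`d > 0`), `dim_ℚ End⁰(B) = 2`,
multiplicity `1` at `i√d` or at `−i√d` — and every `A` isogenous to `B`: `dim A = 6` and `A` is OFF the residue class `𝒞`
(`B` simple with `dim_ℚ End⁰(B) = 2 < 12`, so not of CM type; L7 / L10 transport) — `A` is in the domain of the census
nodes —, AND both census conclusions X2-at-`A`, X1-at-`A` hold (`B = D` on `B`: `AbelianVariety.isDivisorGenerated_of_ribetTypeOne`,
Ribet 1983 Thm. 3 PROVED; divisor summand alone, L7b transport). UNCONDITIONAL; every member, not only the general one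
(coprimality `(5,1)`). [cite: Ribet1983, Thm. 0 and Thm. 3] [cite: Gordon1997, Thm. 6.3 (3) (p. 18)]
[cite: MoonenZarhin1999LowDim, §2 (2.3) and §5 (5.1)] [cite: vanGeemen1994HodgeAV, Lemma 3.7] [cite: Milne1999, §2 p. 54] -/
theorem census_row8_fiveOne {A B : AbelianVariety ℂ} (hB : B.dim = 6) (hs : B.IsSimple) (φ : B ⟶ B) {d : ℕ}
    (hd : 0 < d) (hφ : φ ≫ φ = -(d • 𝟙 B)) (hE2 : Module.finrank ℚ B.endAlgebra = 2)
    (h1 : eigenMultiplicity B φ (Complex.I * (Real.sqrt d : ℂ)) = 1 ∨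
      eigenMultiplicity B φ (-(Complex.I * (Real.sqrt d : ℂ))) = 1) (hAB : IsIsogenous A B) :
    (A.dim = 6 ∧ ¬ (IsOfCMType A ∨ ProdCMCell IsQuarticFieldTypeIVFourfold (fun Z ↦ Z.dim = 2) A)) ∧
    (∀ c : complexBetti A.X (2 * 2), IsRationalClass c → IsOfHodgeType A.dim A.X (2 * 2) 2 2 c →
      c ∈ divisorClassesSpan A.X A.dim 2 ⊔ Submodule.span ℂ {w' : complexBetti A.X (2 * 2) |
        ∃ (C : AbelianVariety ℂ) (g : A.X ⟶ C.X) (w : complexBetti C.X (2 * 2)), C.dim < A.dim ∧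
          IsRationalClass w ∧ IsOfHodgeType C.dim C.X (2 * 2) 2 2 w ∧ w' = complexBetti.map g (2 * 2) w}) ∧
    (∀ c : complexBetti A.X (2 * 3), IsRationalClass c → IsOfHodgeType A.dim A.X (2 * 3) 3 3 c →
      c ∈ divisorClassesSpan A.X A.dim 3 ⊔ Submodule.span ℂ {w' : complexBetti A.X (2 * 3) |
          ∃ (a : complexBetti A.X (2 * 2)) (b : complexBetti A.X (2 * 1)),
            IsRationalClass a ∧ IsOfHodgeType A.dim A.X (2 * 2) 2 2 a ∧ IsRationalClass b ∧
            IsOfHodgeType A.dim A.X (2 * 1) 1 1 b ∧ w' = cupProduct (two_mul_add_two_mul 2 1) a b} ⊔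
        Submodule.span ℂ {w' : complexBetti A.X (2 * 3) |
          ∃ (C : AbelianVariety ℂ) (g : A.X ⟶ C.X) (w : complexBetti C.X (2 * 3)), C.dim < A.dim ∧
            IsRationalClass w ∧ IsOfHodgeType C.dim C.X (2 * 3) 3 3 w ∧ w' = complexBetti.map g (2 * 3) w} ⊔
        Submodule.span ℂ {w' : complexBetti A.X (2 * 3) |
          ∃ (B' : AbelianVariety ℂ) (g : A.X ⟶ B'.X) (d : ℕ) (ψ : B' ⟶ B') (w : complexBetti B'.X (2 * 3)),
            B'.dim = 6 ∧ 0 < d ∧ ψ ≫ ψ = -(d • 𝟙 B') ∧ IsRationalClass w ∧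
            IsOfHodgeType B'.dim B'.X (2 * 3) 3 3 w ∧ w ∈ weilClassesOf B' ψ 3 d ∧
            w' = complexBetti.map g (2 * 3) w}) :=
  ⟨offResidueSix_of_isIsogenous_of_isSimple_of_not_isOfCMType hAB hB hs
      (not_isOfCMType_of_finrank_endAlgebra_lt_two_mul_dim (by omega)),
    census_of_isIsogenous_of_isDivisorGenerated hAB
      (AbelianVariety.isDivisorGenerated_of_ribetTypeOne B φ hd hφ hE2 h1 (by omega))⟩

/-- **Row 8a, all powers (conclusions only)**: for `B` as in `census_row8_fiveOne` and every `A` isogenous to a power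
`B^{N+1}`, X2-at-`A` ∧ X1-at-`A` («`Hdg(Aⁿ) = Div(Aⁿ)` for `n ≥ 1`», Gordon 6.3). UNCONDITIONAL.
[cite: Ribet1983, Thm. 3] [cite: Gordon1997, Thm. 6.3 (3)] [cite: vanGeemen1994HodgeAV, Lemma 3.7] -/
theorem census_row8_fiveOne_powSucc {A B : AbelianVariety ℂ} (hB : B.dim = 6) (φ : B ⟶ B) {d : ℕ}
    (hd : 0 < d) (hφ : φ ≫ φ = -(d • 𝟙 B)) (hE2 : Module.finrank ℚ B.endAlgebra = 2)
    (h1 : eigenMultiplicity B φ (Complex.I * (Real.sqrt d : ℂ)) = 1 ∨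
      eigenMultiplicity B φ (-(Complex.I * (Real.sqrt d : ℂ))) = 1) {N : ℕ}
    (hAB : IsIsogenous A (B.powSucc N)) :
    (∀ c : complexBetti A.X (2 * 2), IsRationalClass c → IsOfHodgeType A.dim A.X (2 * 2) 2 2 c →
      c ∈ divisorClassesSpan A.X A.dim 2 ⊔ Submodule.span ℂ {w' : complexBetti A.X (2 * 2) |
        ∃ (C : AbelianVariety ℂ) (g : A.X ⟶ C.X) (w : complexBetti C.X (2 * 2)), C.dim < A.dim ∧
          IsRationalClass w ∧ IsOfHodgeType C.dim C.X (2 * 2) 2 2 w ∧ w' = complexBetti.map g (2 * 2) w}) ∧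
    (∀ c : complexBetti A.X (2 * 3), IsRationalClass c → IsOfHodgeType A.dim A.X (2 * 3) 3 3 c →
      c ∈ divisorClassesSpan A.X A.dim 3 ⊔ Submodule.span ℂ {w' : complexBetti A.X (2 * 3) |
          ∃ (a : complexBetti A.X (2 * 2)) (b : complexBetti A.X (2 * 1)),
            IsRationalClass a ∧ IsOfHodgeType A.dim A.X (2 * 2) 2 2 a ∧ IsRationalClass b ∧
            IsOfHodgeType A.dim A.X (2 * 1) 1 1 b ∧ w' = cupProduct (two_mul_add_two_mul 2 1) a b} ⊔
        Submodule.span ℂ {w' : complexBetti A.X (2 * 3) |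
          ∃ (C : AbelianVariety ℂ) (g : A.X ⟶ C.X) (w : complexBetti C.X (2 * 3)), C.dim < A.dim ∧
            IsRationalClass w ∧ IsOfHodgeType C.dim C.X (2 * 3) 3 3 w ∧ w' = complexBetti.map g (2 * 3) w} ⊔
        Submodule.span ℂ {w' : complexBetti A.X (2 * 3) |
          ∃ (B' : AbelianVariety ℂ) (g : A.X ⟶ B'.X) (d : ℕ) (ψ : B' ⟶ B') (w : complexBetti B'.X (2 * 3)),
            B'.dim = 6 ∧ 0 < d ∧ ψ ≫ ψ = -(d • 𝟙 B') ∧ IsRationalClass w ∧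
            IsOfHodgeType B'.dim B'.X (2 * 3) 3 3 w ∧ w ∈ weilClassesOf B' ψ 3 d ∧
            w' = complexBetti.map g (2 * 3) w}) :=
  census_of_isIsogenous_powSucc_of_ribetTypeOne φ hd hφ hE2 h1 (by omega) hAB

end RibetTypeOne

/-! ## §2 Row 6 `g6.II(3)` literally: `End⁰(B)` a quaternion algebra over a totally real cubic field -/

section QuaternionCubic

variable {K : Type} [Field K] [NumberField K]

/-- **Both census conclusions at every `A` isogenous to a power `B^{N+1}` of a SIMPLE abelian variety with QUATERNIONIC
MULTIPLICATION OF MINIMAL DIMENSION** (`End⁰(B)` a quaternion algebra over a totally real number field `K`, `dim B = 2[K:ℚ]`;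
type II is forced, `isTotallyIndefinite_of_isSimple_of_dim_eq`): `B•(B^{N+1}) = D•(B^{N+1}) ⊗ ℂ` is the tree theorem
`AbelianVariety.isDivisorGenerated_powSucc_of_isSimple_quaternion_of_dim_eq` (B–G–K Thm. 7.34; Murty 1988 Thm. 2, `m = 1`).
UNCONDITIONAL; any `K` (conclusions only). [cite: BanaszakGajdaKrason2006, Thm. 7.34] [cite: Murty1988, Thm. 2 (p. 67)]
[cite: vanGeemen1994HodgeAV, Lemma 3.7] -/
theorem census_of_isIsogenous_powSucc_of_isSimple_quaternion_of_dim_eq {A B : AbelianVariety ℂ}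
    [Algebra K B.endAlgebra] [IsScalarTower ℚ K B.endAlgebra] [IsQuaternionAlgebra K B.endAlgebra]
    [NumberField.IsTotallyReal K] (hs : B.IsSimple) (hdim : B.dim = 2 * Module.finrank ℚ K) {N : ℕ}
    (hAB : IsIsogenous A (B.powSucc N)) :
    (∀ c : complexBetti A.X (2 * 2), IsRationalClass c → IsOfHodgeType A.dim A.X (2 * 2) 2 2 c →
      c ∈ divisorClassesSpan A.X A.dim 2 ⊔ Submodule.span ℂ {w' : complexBetti A.X (2 * 2) |
        ∃ (C : AbelianVariety ℂ) (g : A.X ⟶ C.X) (w : complexBetti C.X (2 * 2)), C.dim < A.dim ∧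
          IsRationalClass w ∧ IsOfHodgeType C.dim C.X (2 * 2) 2 2 w ∧ w' = complexBetti.map g (2 * 2) w}) ∧
    (∀ c : complexBetti A.X (2 * 3), IsRationalClass c → IsOfHodgeType A.dim A.X (2 * 3) 3 3 c →
      c ∈ divisorClassesSpan A.X A.dim 3 ⊔ Submodule.span ℂ {w' : complexBetti A.X (2 * 3) |
          ∃ (a : complexBetti A.X (2 * 2)) (b : complexBetti A.X (2 * 1)),
            IsRationalClass a ∧ IsOfHodgeType A.dim A.X (2 * 2) 2 2 a ∧ IsRationalClass b ∧
            IsOfHodgeType A.dim A.X (2 * 1) 1 1 b ∧ w' = cupProduct (two_mul_add_two_mul 2 1) a b} ⊔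
        Submodule.span ℂ {w' : complexBetti A.X (2 * 3) |
          ∃ (C : AbelianVariety ℂ) (g : A.X ⟶ C.X) (w : complexBetti C.X (2 * 3)), C.dim < A.dim ∧
            IsRationalClass w ∧ IsOfHodgeType C.dim C.X (2 * 3) 3 3 w ∧ w' = complexBetti.map g (2 * 3) w} ⊔
        Submodule.span ℂ {w' : complexBetti A.X (2 * 3) |
          ∃ (B' : AbelianVariety ℂ) (g : A.X ⟶ B'.X) (d : ℕ) (ψ : B' ⟶ B') (w : complexBetti B'.X (2 * 3)),
            B'.dim = 6 ∧ 0 < d ∧ ψ ≫ ψ = -(d • 𝟙 B') ∧ IsRationalClass w ∧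
            IsOfHodgeType B'.dim B'.X (2 * 3) 3 3 w ∧ w ∈ weilClassesOf B' ψ 3 d ∧
            w' = complexBetti.map g (2 * 3) w}) :=
  census_of_isIsogenous_of_isDivisorGenerated hAB
    (AbelianVariety.isDivisorGenerated_powSucc_of_isSimple_quaternion_of_dim_eq hs hdim N)

/-- **TABLE X ROW 6 `g6.II(3)` LITERALLY, KERNEL VERDICT on the whole isogeny class, WITH DOMAIN MEMBERSHIP.** For a SIMPLE
complex abelian sixfold `B` whose endomorphism algebra is a quaternion algebra over a totally real CUBIC field `K`
(`IsQuaternionAlgebra K End⁰(B)`, `[K:ℚ] = 3`; by `isTotallyIndefinite_of_isSimple_of_dim_eq` it is then totally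
indefinite, i.e. this IS Albert type II(3)) and every `A` isogenous to `B`: `dim A = 6` and `A` is OFF the residue class
`𝒞` (`B` simple with quaternion multiplication is not of CM type, L10c §1), AND X2-at-`A` ∧ X1-at-`A`
(`AbelianVariety.isDivisorGenerated_of_isSimple_quaternion_of_dim_eq` at `dim B = 6 = 2·3`). UNCONDITIONAL; replaces the
«self-commutant totally real sextic subfield» packaging of L10 §3 / L10b by the literal Albert datum.
[cite: BanaszakGajdaKrason2006, Thm. 7.34] [cite: Murty1988, Thm. 2 (p. 67)] [cite: MumfordAV1970, §21 (type II)]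
[cite: MoonenZarhin1999LowDim, (1.8) and §5 (5.1)] [cite: vanGeemen1994HodgeAV, Lemma 3.7] -/
theorem census_row6_typeII_cubic {A B : AbelianVariety ℂ} [Algebra K B.endAlgebra] [IsScalarTower ℚ K B.endAlgebra]
    [IsQuaternionAlgebra K B.endAlgebra] [NumberField.IsTotallyReal K] (hB : B.dim = 6) (hs : B.IsSimple)
    (hK : Module.finrank ℚ K = 3) (hAB : IsIsogenous A B) :
    (A.dim = 6 ∧ ¬ (IsOfCMType A ∨ ProdCMCell IsQuarticFieldTypeIVFourfold (fun Z ↦ Z.dim = 2) A)) ∧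
    (∀ c : complexBetti A.X (2 * 2), IsRationalClass c → IsOfHodgeType A.dim A.X (2 * 2) 2 2 c →
      c ∈ divisorClassesSpan A.X A.dim 2 ⊔ Submodule.span ℂ {w' : complexBetti A.X (2 * 2) |
        ∃ (C : AbelianVariety ℂ) (g : A.X ⟶ C.X) (w : complexBetti C.X (2 * 2)), C.dim < A.dim ∧
          IsRationalClass w ∧ IsOfHodgeType C.dim C.X (2 * 2) 2 2 w ∧ w' = complexBetti.map g (2 * 2) w}) ∧
    (∀ c : complexBetti A.X (2 * 3), IsRationalClass c → IsOfHodgeType A.dim A.X (2 * 3) 3 3 c →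
      c ∈ divisorClassesSpan A.X A.dim 3 ⊔ Submodule.span ℂ {w' : complexBetti A.X (2 * 3) |
          ∃ (a : complexBetti A.X (2 * 2)) (b : complexBetti A.X (2 * 1)),
            IsRationalClass a ∧ IsOfHodgeType A.dim A.X (2 * 2) 2 2 a ∧ IsRationalClass b ∧
            IsOfHodgeType A.dim A.X (2 * 1) 1 1 b ∧ w' = cupProduct (two_mul_add_two_mul 2 1) a b} ⊔
        Submodule.span ℂ {w' : complexBetti A.X (2 * 3) |
          ∃ (C : AbelianVariety ℂ) (g : A.X ⟶ C.X) (w : complexBetti C.X (2 * 3)), C.dim < A.dim ∧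
            IsRationalClass w ∧ IsOfHodgeType C.dim C.X (2 * 3) 3 3 w ∧ w' = complexBetti.map g (2 * 3) w} ⊔
        Submodule.span ℂ {w' : complexBetti A.X (2 * 3) |
          ∃ (B' : AbelianVariety ℂ) (g : A.X ⟶ B'.X) (d : ℕ) (ψ : B' ⟶ B') (w : complexBetti B'.X (2 * 3)),
            B'.dim = 6 ∧ 0 < d ∧ ψ ≫ ψ = -(d • 𝟙 B') ∧ IsRationalClass w ∧
            IsOfHodgeType B'.dim B'.X (2 * 3) 3 3 w ∧ w ∈ weilClassesOf B' ψ 3 d ∧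
            w' = complexBetti.map g (2 * 3) w}) :=
  ⟨offResidueSix_of_isIsogenous_of_isSimple_of_not_isOfCMType hAB hB hs
      (not_isOfCMType_of_isSimple_of_isQuaternionAlgebra K hs (by omega)),
    census_of_isIsogenous_of_isDivisorGenerated hAB
      (AbelianVariety.isDivisorGenerated_of_isSimple_quaternion_of_dim_eq hs (by rw [hK, hB]))⟩

end QuaternionCubic

end Summit.HodgeConjecture.HodgeConjecture.TableX.SimpleRows
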